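import Summits.RiemannHypothesis.RiemannHypothesis.Theorems.MotivicDoorFfDoor
import Summits.RiemannHypothesis.RiemannHypothesis.Theorems.MotivicDoorFfDictionary

/-!
# Motivic door, function-field side (C)(i), part 4: DENSITY in the dial line
(pub-rhdoor seat ff-1.  HONEST FRAMING: lottery ticket at the motivic door; RH probability negligible; consolation
prizes are real: a new semi-local Weil-positivity theorem, or a located gap in the Connes–Consani programme, plus the
ff-door theorem.  No claim about `ζ`; "RH(q,h)" is `|α| = √q` for the roots of one integer polynomial.)

Part 2 (`MotivicDoorFfDoor`) matched every finite-window reader by ONE honest RH-false fake from ffmirror-1's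
dial family V-DIAL.  This file proves the DENSITY form: inside each dial line `{h + kX^g : k ∈ ℤ}` of an honest datum
of dimension `g ≥ 1` — all of whose members are honest (`monic_dial`, `fe_dial`) and share the windows
`T_0, …, T_{g-1}` (`weilWindowForm_dial`) — the RH-true members form a FINITE set (`dialLine_ffRH_finite`),
because RH forces the Weil coefficient bound `|c_k| ≤ C(2g,k) q^{(2g-k)/2}` (`abs_coeff_le_of_ffRH`, from Vieta and
`|e_k(roots)| ≤ C(2g,k) (√q)^k`, `norm_esymm_le_of_norm_eq`) while the dial moves `c_g` through all of `ℤ`.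
Hence (`finiteWindow_accepts_dialLine`, `finiteWindow_fakes_cofinite`): a depth-`M` reader with `M + 1 ≤ g` that
accepts one honest datum accepts infinitely many honest data, all but finitely many of them RH-false.
[folklore: Weil bound on coefficients; Milne, Abelian Varieties §19 Thm 19.1 for the geometric case]

Last section — THE DICTIONARY IS TIGHT (referee-1 C2): for a monic `h` of degree `2g`, the coefficient FE is
EQUIVALENT to ffmirror-2's multiset hypothesis `(frobRoots h).map (q/·) = frobRoots h` together with `c_0 = q^g`
(`fe_iff_map_reciprocal_and_coeff_zero`; ⇐ is `fe_of_map_reciprocal`, via `p ∣ reflect (2g) (p(qX))` from the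
multiplicity transport of part 3 and a degree/leading-coefficient count).  `X² - q` (roots `±√q`, `c_0 = -q`) shows
`c_0 = q^g` cannot be dropped (ref-1's example; not re-proved here).
-/

set_option linter.dupNamespace false

noncomputable section

open Polynomial
open scoped ComplexOrder

open Summit.RiemannHypothesis.RiemannHypothesis.Theorems.PfPersistence.FfAngleTwin

namespace Summit.RiemannHypothesis.RiemannHypothesis.Theorems.MotivicDoor.FunctionField

/-! ## Norm of elementary symmetric functions of points on a circle -/

/-- `‖∏ t‖ = r^{#t}` when every member of `t` has norm `r`. [folklore] -/
theorem norm_multiset_prod_eq_pow {t : Multiset ℂ} {r : ℝ} (ht : ∀ z ∈ t, ‖z‖ = r) :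
    ‖t.prod‖ = r ^ Multiset.card t := by
  induction t using Multiset.induction_on with
  | empty => simp
  | cons a t ih =>
    rw [Multiset.prod_cons, norm_mul, Multiset.card_cons, pow_succ, ht a (Multiset.mem_cons_self a t),
      ih (fun z hz => ht z (Multiset.mem_cons_of_mem hz)), mul_comm]

/-- `|e_k(s)| ≤ C(#s,k) r^k` when every member of `s` has norm `r`. [folklore] -/
theorem norm_esymm_le_of_norm_eq {s : Multiset ℂ} {r : ℝ} (hs : ∀ z ∈ s, ‖z‖ = r) (k : ℕ) :
    ‖s.esymm k‖ ≤ ((Multiset.card s).choose k : ℝ) * r ^ k := by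
  rw [Multiset.esymm]
  refine (norm_multiset_sum_le _).trans (le_of_eq ?_)
  rw [Multiset.map_map]
  have hcongr : ∀ t ∈ s.powersetCard k, ((fun x : ℂ => ‖x‖) ∘ Multiset.prod) t = r ^ k := by
    intro t ht
    obtain ⟨hts, htc⟩ := Multiset.mem_powersetCard.1 ht
    simp only [Function.comp_apply]
    rw [norm_multiset_prod_eq_pow (fun z hz => hs z (Multiset.mem_of_le hts hz)), htc]
  rw [Multiset.map_congr rfl hcongr, Multiset.map_const', Multiset.sum_replicate, Multiset.card_powersetCard,
    nsmul_eq_mul]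

/-! ## The Weil coefficient bound -/

/-- WEIL COEFFICIENT BOUND: `RH(q,h)` for a monic `h` of degree `2g` forces `|c_k| ≤ C(2g,k) (√q)^{2g-k}`.
[folklore; Milne AV §19] -/
theorem abs_coeff_le_of_ffRH {q : ℕ} {h : ℤ[X]} {g : ℕ} (hh : h.Monic) (hdeg : h.natDegree = 2 * g)
    (hRH : ∀ α ∈ frobRoots h, ‖α‖ = Real.sqrt q) {k : ℕ} (hk : k ≤ 2 * g) :
    |(h.coeff k : ℝ)| ≤ ((2 * g).choose k : ℝ) * Real.sqrt q ^ (2 * g - k) := by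
  set p : ℂ[X] := h.map (Int.castRingHom ℂ) with hp
  have hpm : p.Monic := hh.map _
  have hpdeg : p.natDegree = 2 * g := by rw [hp, hh.natDegree_map, hdeg]
  have hpr : p.roots = frobRoots h := rfl
  have hroots : Multiset.card p.roots = p.natDegree := by
    rw [hpr, hpdeg, card_frobRoots_eq_natDegree, hdeg]
  have hV := Polynomial.coeff_eq_esymm_roots_of_card hroots (k := k) (by rw [hpdeg]; exact hk)
  rw [hpm.leadingCoeff, one_mul, hpdeg] at hV
  have hnorm : ‖p.coeff k‖ ≤ ((2 * g).choose k : ℝ) * Real.sqrt q ^ (2 * g - k) := by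
    rw [hV, norm_mul, norm_pow, norm_neg, norm_one, one_pow, one_mul]
    have := norm_esymm_le_of_norm_eq (s := p.roots) (by rw [hpr]; exact hRH) (2 * g - k)
    rwa [hroots, hpdeg, Nat.choose_symm hk] at this
  have hc : p.coeff k = ((h.coeff k : ℤ) : ℂ) := by rw [hp, coeff_map, eq_intCast]
  rwa [hc, Complex.norm_intCast] at hnorm

/-- The dial moves the middle coefficient: `c_g(h + kX^g) = c_g(h) + k`. -/
theorem coeff_dial_middle (h : ℤ[X]) (g : ℕ) (k : ℤ) : (h + C k * X ^ g).coeff g = h.coeff g + k := by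
  simp [coeff_add, coeff_X_pow]

/-- RH-TRUE MEMBERS OF A DIAL LINE HAVE BOUNDED DIAL: `RH(q, h + kX^g) ⇒ |c_g(h) + k| ≤ C(2g,g) (√q)^g`. [folklore] -/
theorem abs_dial_le_of_ffRH {q : ℕ} {h : ℤ[X]} {g : ℕ} (hh : h.Monic) (hdeg : h.natDegree = 2 * g) (hg : 1 ≤ g)
    {k : ℤ} (hRH : ∀ α ∈ frobRoots (h + C k * X ^ g), ‖α‖ = Real.sqrt q) :
    |((h.coeff g + k : ℤ) : ℝ)| ≤ ((2 * g).choose g : ℝ) * Real.sqrt q ^ g := by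
  obtain ⟨hm, hd⟩ := monic_dial hh hdeg hg k
  have := abs_coeff_le_of_ffRH hm hd hRH (k := g) (by omega)
  rwa [coeff_dial_middle, show 2 * g - g = g by omega] at this

/-! ## Density: RH-true members of a dial line are finitely many; the fakes are cofinite -/

/-- FINITELY MANY RH-TRUE MEMBERS in the dial line `{h + kX^g : k ∈ ℤ}` of a monic `h` of degree `2g ≥ 2`:
they all have dial `k ∈ [-c_g - ⌈C(2g,g)(√q)^g⌉, -c_g + ⌈C(2g,g)(√q)^g⌉]`. [folklore] -/
theorem dialLine_ffRH_finite {q : ℕ} {h : ℤ[X]} {g : ℕ} (hh : h.Monic) (hdeg : h.natDegree = 2 * g)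
    (hg : 1 ≤ g) :
    {k : ℤ | ∀ α ∈ frobRoots (h + C k * X ^ g), ‖α‖ = Real.sqrt q}.Finite := by
  set β : ℝ := ((2 * g).choose g : ℝ) * Real.sqrt q ^ g with hβ
  refine (Set.finite_Icc (-h.coeff g - ⌈β⌉) (-h.coeff g + ⌈β⌉)).subset fun k hk => ?_
  have hb := abs_le.1 (abs_dial_le_of_ffRH hh hdeg hg (k := k) hk)
  have h1 : ((h.coeff g + k : ℤ) : ℝ) ≤ ((⌈β⌉ : ℤ) : ℝ) := hb.2.trans (Int.le_ceil β)
  have h2 : ((-(h.coeff g + k) : ℤ) : ℝ) ≤ ((⌈β⌉ : ℤ) : ℝ) := by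
    rw [Int.cast_neg]; linarith [Int.le_ceil β, hb.1]
  have h1' := Int.cast_le.1 h1
  have h2' := Int.cast_le.1 h2
  simp only [Set.mem_Icc]
  constructor <;> omega

/-- … so the RH-FALSE members (the fakes) are COFINITE in the dial line. [folklore] -/
theorem dialLine_fakes_cofinite {q : ℕ} {h : ℤ[X]} {g : ℕ} (hh : h.Monic) (hdeg : h.natDegree = 2 * g)
    (hg : 1 ≤ g) :
    {k : ℤ | ¬ ∀ α ∈ frobRoots (h + C k * X ^ g), ‖α‖ = Real.sqrt q}ᶜ.Finite := by
  simpa only [Set.compl_setOf, not_not] using dialLine_ffRH_finite (q := q) hh hdeg hg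

/-- … and in particular infinitely many members of the dial line violate RH. [folklore] -/
theorem dialLine_fakes_infinite {q : ℕ} {h : ℤ[X]} {g : ℕ} (hh : h.Monic) (hdeg : h.natDegree = 2 * g)
    (hg : 1 ≤ g) :
    {k : ℤ | ¬ ∀ α ∈ frobRoots (h + C k * X ^ g), ‖α‖ = Real.sqrt q}.Infinite := fun hfin =>
  Set.infinite_univ (α := ℤ) (by simpa using hfin.union (dialLine_fakes_cofinite (q := q) hh hdeg hg))

/-! ## The density form of the finite-window half of the door theorem -/

/-- EVERY MEMBER OF THE DIAL LINE IS HONEST (monic, degree `2g`, same functional equation). -/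
theorem dialLine_honest {q : ℕ} {h : ℤ[X]} {g : ℕ} (hh : h.Monic) (hdeg : h.natDegree = 2 * g) (hg : 1 ≤ g)
    (hFE : ∀ i j, i + j = 2 * g → (q : ℤ) ^ g * h.coeff j = (q : ℤ) ^ i * h.coeff i) (k : ℤ) :
    (h + C k * X ^ g).Monic ∧ (h + C k * X ^ g).natDegree = 2 * g ∧
      ∀ i j, i + j = 2 * g → (q : ℤ) ^ g * (h + C k * X ^ g).coeff j = (q : ℤ) ^ i * (h + C k * X ^ g).coeff i :=
  ⟨(monic_dial hh hdeg hg k).1, (monic_dial hh hdeg hg k).2, fe_dial hFE k⟩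

/-- A DEPTH-`M` READER THAT ACCEPTS ONE HONEST DATUM OF DIMENSION `g ≥ M+1` ACCEPTS ITS WHOLE DIAL LINE. -/
theorem finiteWindow_accepts_dialLine {Φ : Tower → Prop} {M : ℕ}
    (hloc : ∀ T T' : Tower, (∀ M' ≤ M, T M' = T' M') → Φ T → Φ T')
    {q : ℕ} {g : ℕ} (hM : M + 1 ≤ g) {h : ℤ[X]} (hh : h.Monic) (hdeg : h.natDegree = 2 * g)
    (hΦ : Φ (weilWindowTower (q : ℝ) h)) (k : ℤ) : Φ (weilWindowTower (q : ℝ) (h + C k * X ^ g)) := by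
  refine hloc _ _ (fun M' hM' => ?_) hΦ
  change weilWindowForm (q : ℝ) h M' = weilWindowForm (q : ℝ) (h + C k * X ^ g) M'
  exact (weilWindowForm_dial (q : ℝ) hh hdeg k (M := M') (by omega)).symm

/-- FF-DOOR (i), FINITE-WINDOW HALF, DENSITY FORM: a depth-`M` reader accepting an honest datum `h` of dimension
`g ≥ M + 1` accepts the infinitely many honest data `h + kX^g`, `k ∈ ℤ`, of which all but finitely many violate
RH: the set of dials `k` giving an ACCEPTED, HONEST, RH-FALSE datum is cofinite in `ℤ`. [folklore] -/
theorem finiteWindow_fakes_cofinite {Φ : Tower → Prop} {M : ℕ}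
    (hloc : ∀ T T' : Tower, (∀ M' ≤ M, T M' = T' M') → Φ T → Φ T')
    {q : ℕ} {g : ℕ} (hM : M + 1 ≤ g) {h : ℤ[X]} (hh : h.Monic) (hdeg : h.natDegree = 2 * g)
    (hFE : ∀ i j, i + j = 2 * g → (q : ℤ) ^ g * h.coeff j = (q : ℤ) ^ i * h.coeff i)
    (hΦ : Φ (weilWindowTower (q : ℝ) h)) :
    {k : ℤ | (h + C k * X ^ g).Monic ∧ (h + C k * X ^ g).natDegree = 2 * g ∧
        (∀ i j, i + j = 2 * g →
          (q : ℤ) ^ g * (h + C k * X ^ g).coeff j = (q : ℤ) ^ i * (h + C k * X ^ g).coeff i) ∧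
        (¬ ∀ α ∈ frobRoots (h + C k * X ^ g), ‖α‖ = Real.sqrt q) ∧
        Φ (weilWindowTower (q : ℝ) (h + C k * X ^ g))}ᶜ.Finite := by
  have hg : 1 ≤ g := le_trans (Nat.le_add_left 1 M) hM
  refine (dialLine_ffRH_finite (q := q) hh hdeg hg).subset fun k hk => ?_
  simp only [Set.mem_compl_iff, Set.mem_setOf_eq, not_and] at hk
  by_contra hRH
  obtain ⟨hm, hd, hfe⟩ := dialLine_honest hh hdeg hg hFE k
  exact (hk hm hd hfe hRH) (finiteWindow_accepts_dialLine hloc hM hh hdeg hΦ k) |>.elim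

/-! ## The dictionary is tight: coefficient FE ⇔ (reciprocal-closed root multiset ∧ c_0 = q^g) -/

/-- Under the multiset hypothesis, root counts are reciprocal-symmetric. -/
theorem count_frobRoots_reciprocal {q : ℕ} (hq : 0 < q) {h : ℤ[X]}
    (hrec : (frobRoots h).map (fun α => (q : ℂ) / α) = frobRoots h) (b : ℂ) :
    Multiset.count ((q : ℂ) / b) (frobRoots h) = Multiset.count b (frobRoots h) := by
  classical
  have hqC : (q : ℂ) ≠ 0 := by exact_mod_cast hq.ne'
  have hinj : Function.Injective (fun α : ℂ => (q : ℂ) / α) := fun x y hxy => by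
    simpa only [div_div_cancel₀ hqC] using congrArg (fun α : ℂ => (q : ℂ) / α) hxy
  conv_lhs => rw [← hrec]
  exact Multiset.count_map_eq_count' _ _ hinj b

/-- CONVERSE DICTIONARY: reciprocal-closed root multiset and `c_0 = q^g` imply the coefficient FE. [folklore] -/
theorem fe_of_map_reciprocal {q : ℕ} (hq : 0 < q) {h : ℤ[X]} {g : ℕ} (hh : h.Monic)
    (hdeg : h.natDegree = 2 * g) (hrec : (frobRoots h).map (fun α => (q : ℂ) / α) = frobRoots h)
    (hc0 : h.coeff 0 = (q : ℤ) ^ g) :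
    ∀ i j, i + j = 2 * g → (q : ℤ) ^ g * h.coeff j = (q : ℤ) ^ i * h.coeff i := by
  classical
  have hqC : (q : ℂ) ≠ 0 := by exact_mod_cast hq.ne'
  set p : ℂ[X] := h.map (Int.castRingHom ℂ) with hp
  have hpm : p.Monic := hh.map _
  have hpdeg : p.natDegree = 2 * g := by rw [hp, hh.natDegree_map, hdeg]
  have hpr : p.roots = frobRoots h := rfl
  have hroots : Multiset.card p.roots = p.natDegree := by
    rw [hpr, hpdeg, card_frobRoots_eq_natDegree, hdeg]
  have hpc : ∀ k, p.coeff k = ((h.coeff k : ℤ) : ℂ) := fun k => by rw [hp, coeff_map, eq_intCast]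
  have hp0 : p.coeff 0 = (q : ℂ) ^ g := by rw [hpc, hc0]; push_cast; rfl
  -- the reflected rescaled polynomial `L = x^{2g} p(q/x)`
  set L : ℂ[X] := reflect (2 * g) (p.comp (C (q : ℂ) * X)) with hL
  have hcdeg : (p.comp (C (q : ℂ) * X)).natDegree ≤ 2 * g := by
    refine natDegree_le_iff_coeff_eq_zero.2 fun i hi => ?_
    rw [comp_C_mul_X_coeff, coeff_eq_zero_of_natDegree_lt (by rw [hpdeg]; exact_mod_cast hi), zero_mul]
  have hLcoeff : ∀ i ≤ 2 * g, L.coeff i = p.coeff (2 * g - i) * (q : ℂ) ^ (2 * g - i) := fun i hi => by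
    rw [hL, coeff_reflect, revAt_le hi, comp_C_mul_X_coeff]
  have hLtop : L.coeff (2 * g) = (q : ℂ) ^ g := by
    rw [hLcoeff _ le_rfl, Nat.sub_self, pow_zero, mul_one, hp0]
  have hL0 : L ≠ 0 := fun h0 => by
    have := hLtop
    rw [h0, coeff_zero] at this
    exact pow_ne_zero _ hqC this.symm
  have hLdeg : L.natDegree ≤ 2 * g := natDegree_reflect_le.trans (max_le le_rfl hcdeg)
  -- `p` has no root at `0`
  have hR0 : ¬ p.IsRoot 0 := fun h0 => by
    rw [IsRoot.def, ← coeff_zero_eq_eval_zero, hp0] at h0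
    exact pow_ne_zero _ hqC h0
  -- every root of `p`, with multiplicity, is a root of `L`
  have hle : p.roots ≤ L.roots := by
    refine Multiset.le_iff_count.2 fun β => ?_
    rw [count_roots, count_roots]
    by_cases hβ : β = 0
    · subst hβ; rw [rootMultiplicity_eq_zero hR0]; exact Nat.zero_le _
    · have h1 := X_sub_C_div_pow_dvd_comp hqC (pow_rootMultiplicity_dvd p ((q : ℂ) / β))
      have h2 := X_sub_C_inv_pow_dvd_reflect hcdeg (div_ne_zero (div_ne_zero hqC hβ) hqC) h1
      have hβ' : (((q : ℂ) / β) / (q : ℂ))⁻¹ = β := by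
        rw [div_right_comm, div_self hqC, one_div, inv_inv]
      rw [hβ', ← hL] at h2
      have hc := count_frobRoots_reciprocal hq hrec β
      rw [← hpr, count_roots, count_roots] at hc
      calc rootMultiplicity β p = rootMultiplicity ((q : ℂ) / β) p := hc.symm
        _ ≤ rootMultiplicity β L := (le_rootMultiplicity_iff hL0).2 h2
  -- hence `p ∣ L`, and comparing degrees and top coefficients `L = q^g · p`
  have hdvd : p ∣ L := by
    have := (Multiset.prod_X_sub_C_dvd_iff_le_roots hL0 p.roots).2 hle
    rwa [prod_multiset_X_sub_C_of_monic_of_roots_card_eq hpm hroots] at this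
  obtain ⟨r, hr⟩ := hdvd
  have hr0 : r ≠ 0 := by
    rintro rfl
    exact hL0 (by rw [hr, mul_zero])
  have hrdeg : r.natDegree = 0 := by
    have := hLdeg
    rw [hr, natDegree_mul hpm.ne_zero hr0, hpdeg] at this
    omega
  obtain ⟨c, hc⟩ : ∃ c, r = C c := ⟨_, eq_C_of_natDegree_eq_zero hrdeg⟩
  rw [hc] at hr
  have hcq : c = (q : ℂ) ^ g := by
    have := hLtop
    rwa [hr, coeff_mul_C, ← hpdeg, hpm.coeff_natDegree, one_mul] at this
  -- read off the functional equation coefficientwise and descend to `ℤ`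
  intro i j hij
  have key := hLcoeff j (by omega)
  rw [hr, coeff_mul_C, hcq, show 2 * g - j = i by omega, hpc, hpc] at key
  -- key : ↑c_j * q^g = ↑c_i * q^i
  have : (((q : ℤ) ^ g * h.coeff j : ℤ) : ℂ) = (((q : ℤ) ^ i * h.coeff i : ℤ) : ℂ) := by
    push_cast
    linear_combination key
  exact_mod_cast this

/-- THE DICTIONARY IS TIGHT: for monic `h` of degree `2g`, COEFFICIENT FE ⇔ (ffmirror-2's multiset reciprocal
closure ∧ `c_0 = q^g`). [folklore] -/
theorem fe_iff_map_reciprocal_and_coeff_zero {q : ℕ} (hq : 0 < q) {h : ℤ[X]} {g : ℕ} (hh : h.Monic)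
    (hdeg : h.natDegree = 2 * g) :
    (∀ i j, i + j = 2 * g → (q : ℤ) ^ g * h.coeff j = (q : ℤ) ^ i * h.coeff i) ↔
      ((frobRoots h).map (fun α => (q : ℂ) / α) = frobRoots h ∧ h.coeff 0 = (q : ℤ) ^ g) := by
  refine ⟨fun hFE => ⟨frobRoots_map_reciprocal hq hdeg hFE, ?_⟩,
    fun hrc => fe_of_map_reciprocal hq hh hdeg hrc.1 hrc.2⟩
  have htop : h.coeff (2 * g) = 1 := by rw [← hdeg]; exact hh.coeff_natDegree
  have h20 := hFE (2 * g) 0 (by omega)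
  rw [htop, mul_one, show 2 * g = g + g by omega, pow_add] at h20
  have hqZ : ((q : ℤ) ^ g) ≠ 0 := pow_ne_zero _ (by exact_mod_cast hq.ne')
  exact mul_left_cancel₀ hqZ h20

end Summit.RiemannHypothesis.RiemannHypothesis.Theorems.MotivicDoor.FunctionField

end
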